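import Summits.QuantumFields.YangMills.Theorems.SwapVirialDeficitTwoScaleCalculus
import HarnessLib

/-!
# Two-scale calculus II (PM-IIa′ of LEAD memo `sfw-p2-g96-memo-24196-PM-design.md`): minima along lines, the Hessian at a minimum (PSD, null directions),
# the 2-jet along a PARABOLA through a flat minimum, and the structure theorem with SLICE hypotheses
# (free-hands support of ⟨stmt-QuantumFields-24196⟩ `SwapVirialDeficit.ToronSoftnessSharp`; GENERIC real analysis, Mathlib + ✓`…TwoScaleCalculus` only)

✓`TwoScaleCalculus.eq_pow_four_mul_sq_mul_twoScaleRemainder` factors a smooth plane function as `u⁴s²·Φ` from four slice-vanishing hypotheses.  For the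
periodic two-scale deficit `G(u, s; ξ)` (✓`BlowUpRing.twoScaleDeficit`) those hypotheses come from THREE facts only (LEAD memo §1): smoothness, toron
flatness, non-negativity.  This file supplies the generic calculus that turns «non-negative, flat along certain lines» into the vanishing of jets:
* §7 `taylor_integral_real`, ★ `iteratedDeriv_two_nonneg_of_isMinOn` (second-derivative test), ★ `iteratedDeriv_three_eq_zero_of_isMinOn` (LEMMA C: a `C^∞`
  function with a global minimum and vanishing second derivative has vanishing third derivative);
* §8 `hess f p = D²f(p)` as a bilinear form; `dirDerivIter_two_eq_hess`, `hess_comm`, `iteratedDeriv_two_line_eq_hess`, ★ `hess_nonneg_of_isMinOn` (PSD at a minimum),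
  ★ `bilin_apply_eq_zero_of_psd_of_self_eq_zero` (PSD Cauchy–Schwarz), ★★ `hess_apply_eq_zero_of_line_const` (LEMMA H, abstract: a direction along which `f` is
  constant through a minimum is in the KERNEL of the Hessian), `hess_apply_eq_zero_of_sum`;
* §9 ★★ `iteratedDeriv_two_parabola_eq_zero` / ★★★ `iteratedDeriv_parabola_eq_zero` — along the parabola `u ↦ p + u c₁ + u² c₂` through a global minimum with
  `D²f(p)[c₁][·] = 0`, the function `f(·) − f(p)` has vanishing jets of order `0,1,2,3` (the follower letters of the two-scale family enter at order `u²`);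
* §10 `dirDerivIter_eU_eq_iteratedDeriv`, `dirDeriv_eS_eq_deriv`, ★★ `eq_pow_four_mul_sq_of_slices` — the structure theorem with hypotheses `F ≥ 0`, `F(u,0) = F(0,s) = 0`,
  and vanishing 2nd/3rd `u`-derivatives of the horizontal slices at `0` (first derivatives are automatic at the minimum lines).
HONEST LABEL: textbook calculus (plumbing for a plan-level fixed-`L` rung of a DRAFT line); nothing of PM, ⟨24196⟩ or ⟨24197⟩ is proved; own crux ⟨22884⟩ OPEN
(blocked-on ⟨19935⟩); the Yang–Mills mass gap is NOT proved; no summit is proved by a line.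
LEAD seat ym-line-sfw-p2 g96 (cell ym-idea-1, free hands), `--supports stmt-QuantumFields-24196`.  One `def` (`hess`), standard axioms, 0 `sorry`.
References: [folklore] (Taylor with integral remainder; second-derivative test; Cauchy–Schwarz for positive semi-definite forms; Schwarz's theorem).
-/

set_option autoImplicit false

noncomputable section

open Set Filter Topology intervalIntegral
open scoped BigOperators ContDiff

namespace Summit.QuantumFields.YangMills.Theorems.SwapVirialDeficit.TwoScaleCalculus

/-! ## §7 Slices of a plane function; minima along lines -/

section Slices

variable {E : Type*} [NormedAddCommGroup E] [NormedSpace ℝ E]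


/-- On `E = ℝ` with `p = 0`, `v = 1`: `∂_1ᵏ φ = φ⁽ᵏ⁾`. [folklore] -/
theorem dirDerivIter_one_eq_iteratedDeriv {φ : ℝ → ℝ} (hφ : ContDiff ℝ ∞ φ) (k : ℕ) (t : ℝ) :
    dirDerivIter (1 : ℝ) k φ t = iteratedDeriv k φ t := by
  have e := iteratedDeriv_comp_line hφ (0 : ℝ) (1 : ℝ) k
  have hid : (fun t : ℝ => φ (0 + t • (1 : ℝ))) = φ := by funext t; simp
  rw [hid] at e
  have := congrFun e t
  simpa using this.symm

/-- ★ **Taylor for a real function, integral remainder, in `iteratedDeriv` form**: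
`φ t = Σ_{k ≤ n} tᵏ/k!·φ⁽ᵏ⁾(0) + tⁿ⁺¹/n!·∫₀¹ (1 − τ)ⁿ φ⁽ⁿ⁺¹⁾(τ t) dτ`. [folklore] -/
theorem taylor_integral_real {φ : ℝ → ℝ} (hφ : ContDiff ℝ ∞ φ) (t : ℝ) (n : ℕ) :
    φ t = (∑ k ∈ Finset.range (n + 1), t ^ k / (k.factorial : ℝ) * iteratedDeriv k φ 0) +
      t ^ (n + 1) / (n.factorial : ℝ) * ∫ τ in (0:ℝ)..1, (1 - τ) ^ n * iteratedDeriv (n + 1) φ (τ * t) := by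
  have h := taylor_line_integral hφ (0 : ℝ) (1 : ℝ) t n
  simp only [smul_eq_mul, mul_one, zero_add, dirDerivIter_one_eq_iteratedDeriv hφ] at h
  exact h

/-- ★ **Second-derivative test, integral form**: if `φ` is `C^∞`, `0` is a global minimum and `φ'(0) = 0` is used through the minimum, then
`0 ≤ φ''(0)`. [folklore] -/
theorem iteratedDeriv_two_nonneg_of_isMinOn {φ : ℝ → ℝ} (hφ : ContDiff ℝ ∞ φ) (hmin : ∀ t, φ 0 ≤ φ t) : 0 ≤ iteratedDeriv 2 φ 0 := by
  have hloc : IsLocalMin φ 0 := Filter.Eventually.of_forall hmin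
  have h1 : iteratedDeriv 1 φ 0 = 0 := by rw [iteratedDeriv_one]; exact hloc.deriv_eq_zero
  -- `(φ t − φ 0)/t² = ∫₀¹ (1−τ) φ''(τ t) dτ → φ''(0)/2`
  set I : ℝ → ℝ := fun t => ∫ τ in (0:ℝ)..1, (1 - τ) * iteratedDeriv 2 φ (τ * t) with hI
  have hrep : ∀ t, φ t - φ 0 = t ^ 2 * I t := by
    intro t
    have h := taylor_integral_real hφ t 1
    rw [Finset.sum_range_succ, Finset.sum_range_succ, Finset.sum_range_zero] at h
    norm_num [h1] at h
    rw [hI]; linarith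
  have hcont : Continuous I := by
    have h2c : Continuous (iteratedDeriv 2 φ) := by
      have e : iteratedDeriv 2 φ = dirDerivIter (1 : ℝ) 2 φ := funext fun t => (dirDerivIter_one_eq_iteratedDeriv hφ 2 t).symm
      rw [e]; exact (contDiff_dirDerivIter hφ 1 2).continuous
    refine intervalIntegral.continuous_parametric_intervalIntegral_of_continuous' ?_ 0 1
    exact (continuous_const.sub continuous_snd).mul (h2c.comp (continuous_snd.mul continuous_fst))
  have hI0 : I 0 = iteratedDeriv 2 φ 0 / 2 := by
    rw [hI]
    simp only [mul_zero]
    rw [intervalIntegral.integral_mul_const]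
    have : ∫ τ in (0:ℝ)..1, (1 - τ) = 1 / 2 := by norm_num [integral_comp_sub_left fun x => x]
    rw [this]; ring
  -- `I t ≥ 0` for `t ≠ 0`, hence at `t = 0` by continuity
  have hpos : ∀ t : ℝ, t ≠ 0 → 0 ≤ I t := by
    intro t ht
    have h := hrep t
    have ht2 : 0 < t ^ 2 := by positivity
    have : 0 ≤ t ^ 2 * I t := by rw [← h]; linarith [hmin t]
    nlinarith
  have hlim : Tendsto I (𝓝[≠] 0) (𝓝 (I 0)) := (hcont.tendsto 0).mono_left nhdsWithin_le_nhds
  have hge : 0 ≤ I 0 := ge_of_tendsto hlim (eventually_nhdsWithin_of_forall fun t ht => hpos t ht)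
  rw [hI0] at hge
  linarith

/-- ★ **No cubic term at a flat minimum**: if `φ` is `C^∞`, `0` is a global minimum and `φ''(0) = 0`, then `φ'''(0) = 0`
(`(φ t − φ 0)/t³ → φ'''(0)/6` has both signs). [folklore] -/
theorem iteratedDeriv_three_eq_zero_of_isMinOn {φ : ℝ → ℝ} (hφ : ContDiff ℝ ∞ φ) (hmin : ∀ t, φ 0 ≤ φ t) (h2 : iteratedDeriv 2 φ 0 = 0) :
    iteratedDeriv 3 φ 0 = 0 := by
  have hloc : IsLocalMin φ 0 := Filter.Eventually.of_forall hmin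
  have h1 : iteratedDeriv 1 φ 0 = 0 := by rw [iteratedDeriv_one]; exact hloc.deriv_eq_zero
  set I : ℝ → ℝ := fun t => ∫ τ in (0:ℝ)..1, (1 - τ) ^ 2 * iteratedDeriv 3 φ (τ * t) with hI
  have hrep : ∀ t, φ t - φ 0 = t ^ 3 / 2 * I t := by
    intro t
    have h := taylor_integral_real hφ t 2
    rw [Finset.sum_range_succ, Finset.sum_range_succ, Finset.sum_range_succ, Finset.sum_range_zero] at h
    norm_num [h1, h2, Nat.factorial] at h
    rw [hI]; linarith
  have hcont : Continuous I := by
    have h3c : Continuous (iteratedDeriv 3 φ) := by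
      have e : iteratedDeriv 3 φ = dirDerivIter (1 : ℝ) 3 φ := funext fun t => (dirDerivIter_one_eq_iteratedDeriv hφ 3 t).symm
      rw [e]; exact (contDiff_dirDerivIter hφ 1 3).continuous
    refine intervalIntegral.continuous_parametric_intervalIntegral_of_continuous' ?_ 0 1
    exact ((continuous_const.sub continuous_snd).pow 2).mul (h3c.comp (continuous_snd.mul continuous_fst))
  have hI0 : I 0 = iteratedDeriv 3 φ 0 / 3 := by
    rw [hI]
    simp only [mul_zero]
    rw [intervalIntegral.integral_mul_const]
    have : ∫ τ in (0:ℝ)..1, (1 - τ) ^ 2 = 1 / 3 := by norm_num [integral_comp_sub_left fun x => x ^ 2]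
    rw [this]; ring
  have hpos : ∀ t : ℝ, 0 < t → 0 ≤ I t := by
    intro t ht
    have h := hrep t
    have : 0 ≤ t ^ 3 / 2 * I t := by rw [← h]; linarith [hmin t]
    have ht3 : 0 < t ^ 3 / 2 := by positivity
    nlinarith
  have hneg : ∀ t : ℝ, t < 0 → I t ≤ 0 := by
    intro t ht
    have h := hrep t
    have : 0 ≤ t ^ 3 / 2 * I t := by rw [← h]; linarith [hmin t]
    have ht3 : t ^ 3 / 2 < 0 := by
      have : t ^ 3 < 0 := by
        have := Odd.pow_neg (show Odd 3 by decide) ht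
        simpa using this
      linarith
    nlinarith
  have hlimp : Tendsto I (𝓝[>] 0) (𝓝 (I 0)) := (hcont.tendsto 0).mono_left nhdsWithin_le_nhds
  have hlimn : Tendsto I (𝓝[<] 0) (𝓝 (I 0)) := (hcont.tendsto 0).mono_left nhdsWithin_le_nhds
  have hge : 0 ≤ I 0 := ge_of_tendsto hlimp (eventually_nhdsWithin_of_forall fun t ht => hpos t ht)
  have hle : I 0 ≤ 0 := le_of_tendsto hlimn (eventually_nhdsWithin_of_forall fun t ht => hneg t ht)
  have : I 0 = 0 := le_antisymm hle hge
  rw [hI0] at this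
  linarith

end Slices

/-! ## §8 The Hessian at a minimum: PSD, and null directions are null for the whole form -/

section Hessian

variable {E : Type*} [NormedAddCommGroup E] [NormedSpace ℝ E]

/-- The Hessian of `f` at `p` as a bilinear form `D²f(p)[v][w]`. [folklore] -/
def hess (f : E → ℝ) (p : E) : E →L[ℝ] E →L[ℝ] ℝ := fderiv ℝ (fderiv ℝ f) p

/-- `∂_v ∂_w f (p) = D²f(p)[v][w]` for `C^∞` `f`. [folklore] -/
theorem dirDeriv_dirDeriv_eq_hess {f : E → ℝ} (hf : ContDiff ℝ ∞ f) (v w p : E) : dirDeriv v (dirDeriv w f) p = hess f p v w := by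
  have hd : DifferentiableAt ℝ (fderiv ℝ f) p :=
    ((hf.fderiv_right (m := ∞) (by simp)).differentiable (by simp)).differentiableAt
  unfold dirDeriv hess
  rw [fderiv_clm_apply hd (differentiableAt_const w), fderiv_fun_const]
  simp

/-- `∂_v² f (p) = D²f(p)[v][v]`. [folklore] -/
theorem dirDerivIter_two_eq_hess {f : E → ℝ} (hf : ContDiff ℝ ∞ f) (v p : E) : dirDerivIter v 2 f p = hess f p v v := by
  rw [dirDerivIter_succ, show dirDerivIter v 1 f = dirDeriv v f from rfl, dirDeriv_dirDeriv_eq_hess hf]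

/-- The Hessian of a `C^∞` function is symmetric (✓`ContDiffAt.isSymmSndFDerivAt`). [folklore] -/
theorem hess_comm {f : E → ℝ} (hf : ContDiff ℝ ∞ f) (p v w : E) : hess f p v w = hess f p w v := by
  have h2 : minSmoothness ℝ 2 ≤ (∞ : ℕ∞ω) := by
    simp only [minSmoothness_of_isRCLikeNormedField]
    exact WithTop.coe_le_coe.mpr le_top
  exact (hf.contDiffAt.isSymmSndFDerivAt h2) v w

/-- The second derivative of the line slice `t ↦ f (p + t • v)` at `0` is `D²f(p)[v][v]`. [folklore] -/
theorem iteratedDeriv_two_line_eq_hess {f : E → ℝ} (hf : ContDiff ℝ ∞ f) (p v : E) :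
    iteratedDeriv 2 (fun t : ℝ => f (p + t • v)) 0 = hess f p v v := by
  have e := congrFun (iteratedDeriv_comp_line hf p v 2) 0
  simp only [zero_smul, add_zero] at e
  rw [e, dirDerivIter_two_eq_hess hf]

/-- ★ **The Hessian at a global minimum is positive semi-definite.** [folklore] -/
theorem hess_nonneg_of_isMinOn {f : E → ℝ} (hf : ContDiff ℝ ∞ f) {p : E} (hmin : ∀ x, f p ≤ f x) (v : E) : 0 ≤ hess f p v v := by
  rw [← iteratedDeriv_two_line_eq_hess hf p v]
  refine iteratedDeriv_two_nonneg_of_isMinOn (contDiff_comp_line hf p v) fun t => ?_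
  simpa using hmin (p + t • v)

/-- ★ **PSD Cauchy–Schwarz**: for a symmetric positive semi-definite bilinear form, a null vector is in the kernel:
`B a a = 0 ⟹ B a w = 0`. [folklore] -/
theorem bilin_apply_eq_zero_of_psd_of_self_eq_zero (B : E →L[ℝ] E →L[ℝ] ℝ) (hpsd : ∀ v, 0 ≤ B v v) (hsymm : ∀ v w, B v w = B w v)
    {a : E} (ha : B a a = 0) (w : E) : B a w = 0 := by
  set c := B a w with hc
  set d := B w w with hd
  have hd0 : 0 ≤ d := hpsd w
  have key : ∀ t : ℝ, 0 ≤ 2 * t * c + t ^ 2 * d := by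
    intro t
    have h := hpsd (a + t • w)
    have hexp : B (a + t • w) (a + t • w) = B a a + t * B a w + t * B w a + t ^ 2 * B w w := by
      simp only [map_add, map_smul, FunLike.coe_add, Pi.add_apply, FunLike.coe_smul, Pi.smul_apply, smul_eq_mul]
      ring
    rw [hexp, ha, hsymm w a, ← hc, ← hd] at h
    linarith
  -- take `t = -c/(d+1)`
  have h := key (-c / (d + 1))
  have hd1 : 0 < d + 1 := by linarith
  have : 2 * (-c / (d + 1)) * c + (-c / (d + 1)) ^ 2 * d = -(c ^ 2) * (d + 2) / (d + 1) ^ 2 := by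
    field_simp; ring
  rw [this] at h
  have hnum : -(c ^ 2) * (d + 2) / (d + 1) ^ 2 ≤ 0 := by
    apply div_nonpos_of_nonpos_of_nonneg
    · nlinarith [sq_nonneg c]
    · positivity
  have h0 : -(c ^ 2) * (d + 2) / (d + 1) ^ 2 = 0 := le_antisymm hnum h
  have : c ^ 2 * (d + 2) = 0 := by
    have hne : (d + 1) ^ 2 ≠ 0 := by positivity
    have := div_eq_zero_iff.1 h0
    rcases this with h' | h'
    · linarith
    · exact absurd h' hne
  have hc2 : c ^ 2 = 0 := by
    rcases mul_eq_zero.1 this with h' | h'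
    · exact h'
    · linarith
  exact pow_eq_zero_iff (two_ne_zero) |>.1 hc2

/-- ★★ **Null directions of the Hessian at a minimum**: if `p` is a global minimum of a `C^∞` `f` and `f` is CONSTANT along the line `p + ℝa`,
then `D²f(p)[a][·] = 0`. [folklore] -/
theorem hess_apply_eq_zero_of_line_const {f : E → ℝ} (hf : ContDiff ℝ ∞ f) {p : E} (hmin : ∀ x, f p ≤ f x) {a : E}
    (hline : ∀ t : ℝ, f (p + t • a) = f p) (w : E) : hess f p a w = 0 := by
  refine bilin_apply_eq_zero_of_psd_of_self_eq_zero (hess f p) (hess_nonneg_of_isMinOn hf hmin) (hess_comm hf p) ?_ w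
  -- `D²f(p)[a][a] = (d/dt)² f(p + t a) |₀ = 0`
  rw [← iteratedDeriv_two_line_eq_hess hf p a]
  have hc : (fun t : ℝ => f (p + t • a)) = fun _ => f p := funext hline
  rw [hc, iteratedDeriv_const]
  simp

/-- The kernel of the Hessian at a minimum is a subspace: sums of null directions are null. [folklore] -/
theorem hess_apply_eq_zero_of_sum {f : E → ℝ} (p : E) {ι : Type*} (s : Finset ι) (a : ι → E)
    (h : ∀ i ∈ s, ∀ w, hess f p (a i) w = 0) (w : E) : hess f p (∑ i ∈ s, a i) w = 0 := by
  rw [map_sum, FunLike.coe_sum, Finset.sum_apply]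
  exact Finset.sum_eq_zero fun i hi => h i hi w

end Hessian

/-! ## §9 The 2-jet of a function along a parabola through a minimum -/

section Parabola

variable {E : Type*} [NormedAddCommGroup E] [NormedSpace ℝ E]

/-- The parabola `γ(u) = p + u • c₁ + u² • c₂` and its derivative. [folklore] -/
theorem hasDerivAt_parabola (p c₁ c₂ : E) (u : ℝ) :
    HasDerivAt (fun u : ℝ => p + u • c₁ + u ^ 2 • c₂) (c₁ + (2 * u) • c₂) u := by
  have h1 : HasDerivAt (fun u : ℝ => u • c₁) ((1 : ℝ) • c₁) u := (hasDerivAt_id u).smul_const c₁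
  have h2 : HasDerivAt (fun u : ℝ => u ^ 2 • c₂) ((2 * u) • c₂) u := by
    have := (hasDerivAt_pow 2 u).smul_const c₂
    simpa using this
  have h := (h1.const_add p).fun_add h2
  simpa using h

/-- ★★ **PARABOLA 2-JET**: let `f` be `C^∞` with a global minimum at `p`, and suppose `c₁` is a null direction of the Hessian, `D²f(p)[c₁][·] = 0`.
Then `φ(u) := f (p + u • c₁ + u² • c₂)` has `φ'(0) = 0` and `φ''(0) = 0` (the curvature term `Df(p)[2c₂]` dies at the minimum). [folklore] -/
theorem iteratedDeriv_two_parabola_eq_zero {f : E → ℝ} (hf : ContDiff ℝ ∞ f) {p : E} (hmin : ∀ x, f p ≤ f x) {c₁ : E}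
    (hH : ∀ w, hess f p c₁ w = 0) (c₂ : E) :
    deriv (fun u : ℝ => f (p + u • c₁ + u ^ 2 • c₂)) 0 = 0 ∧ iteratedDeriv 2 (fun u : ℝ => f (p + u • c₁ + u ^ 2 • c₂)) 0 = 0 := by
  set γ : ℝ → E := fun u => p + u • c₁ + u ^ 2 • c₂ with hγ
  have hfd : ∀ x, HasFDerivAt f (fderiv ℝ f x) x := fun x => ((hf.differentiable (by simp)).differentiableAt).hasFDerivAt
  have hffd : ∀ x, HasFDerivAt (fderiv ℝ f) (hess f x) x := fun x =>
    (((hf.fderiv_right (m := ∞) (by simp)).differentiable (by simp)).differentiableAt).hasFDerivAt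
  -- first derivative of `φ = f ∘ γ`
  have hφ' : ∀ u, HasDerivAt (fun u : ℝ => f (γ u)) (fderiv ℝ f (γ u) (c₁ + (2 * u) • c₂)) u :=
    fun u => (hfd (γ u)).comp_hasDerivAt u (hasDerivAt_parabola p c₁ c₂ u)
  have hderiv : deriv (fun u : ℝ => f (γ u)) = fun u => fderiv ℝ f (γ u) (c₁ + (2 * u) • c₂) := funext fun u => (hφ' u).deriv
  -- the minimum kills `Df(p)`
  have hp : IsLocalMin f p := Filter.Eventually.of_forall hmin
  have hDf : fderiv ℝ f p = 0 := hp.fderiv_eq_zero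
  have hγ0 : γ 0 = p := by simp [hγ]
  refine ⟨?_, ?_⟩
  · rw [hderiv]; simp only [mul_zero, zero_smul, add_zero, hγ0, hDf, FunLike.coe_zero, Pi.zero_apply]
  · rw [iteratedDeriv_succ, iteratedDeriv_one, hderiv]
    -- derivative of `u ↦ Df(γ u)[γ'(u)]` by the `clm_apply` product rule
    have hc : HasDerivAt (fun u : ℝ => fderiv ℝ f (γ u)) (hess f (γ 0) (c₁ + (2 * (0:ℝ)) • c₂)) 0 :=
      (hffd (γ 0)).comp_hasDerivAt 0 (hasDerivAt_parabola p c₁ c₂ 0)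
    have hv : HasDerivAt (fun u : ℝ => c₁ + (2 * u) • c₂) ((2 : ℝ) • c₂) 0 := by
      have := ((hasDerivAt_id (0 : ℝ)).const_mul 2).smul_const c₂
      simpa using this.const_add c₁
    have h := hc.clm_apply hv
    rw [h.deriv]
    simp only [mul_zero, zero_smul, add_zero, hγ0, hDf, FunLike.coe_zero, Pi.zero_apply, hH c₁]

/-- ★★★ **THE 4-JET ALONG A PARABOLA THROUGH A FLAT MINIMUM VANISHES TO ORDER 3**: with `f`, `p`, `c₁`, `c₂` as above,
`φ(u) = f(p + u c₁ + u² c₂) − f(p)` has `φ⁽ᵏ⁾(0) = 0` for `k = 0, 1, 2, 3` (the `k = 3` case by ✓`iteratedDeriv_three_eq_zero_of_isMinOn`). [folklore] -/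
theorem iteratedDeriv_parabola_eq_zero {f : E → ℝ} (hf : ContDiff ℝ ∞ f) {p : E} (hmin : ∀ x, f p ≤ f x) {c₁ : E}
    (hH : ∀ w, hess f p c₁ w = 0) (c₂ : E) (k : ℕ) (hk : k < 4) :
    iteratedDeriv k (fun u : ℝ => -f p + f (p + u • c₁ + u ^ 2 • c₂)) 0 = 0 := by
  set g : ℝ → ℝ := fun u => f (p + u • c₁ + u ^ 2 • c₂) with hg
  set φ : ℝ → ℝ := fun u => -f p + f (p + u • c₁ + u ^ 2 • c₂) with hφ
  have hγs : ContDiff ℝ ∞ (fun u : ℝ => p + u • c₁ + u ^ 2 • c₂) :=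
    (contDiff_const.add (contDiff_id.smul contDiff_const)).add ((contDiff_id.pow 2).smul contDiff_const)
  have hφs : ContDiff ℝ ∞ φ := contDiff_const.add (hf.comp hγs)
  have hφmin : ∀ t, φ 0 ≤ φ t := fun t => by simp only [hφ]; simpa using hmin _
  obtain ⟨h1, h2⟩ := iteratedDeriv_two_parabola_eq_zero hf hmin hH c₂
  have hshift : ∀ {j : ℕ}, 0 < j → iteratedDeriv j φ = iteratedDeriv j g := fun hj => by
    rw [hφ, hg]; funext x; exact iteratedDeriv_const_add (f := fun u : ℝ => f (p + u • c₁ + u ^ 2 • c₂)) hj (-f p)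
  have h1' : iteratedDeriv 1 φ 0 = 0 := by rw [hshift one_pos, iteratedDeriv_one, hg, h1]
  have h2' : iteratedDeriv 2 φ 0 = 0 := by rw [hshift two_pos, hg, h2]
  interval_cases k
  · simp [hφ]
  · exact h1'
  · exact h2'
  · exact iteratedDeriv_three_eq_zero_of_isMinOn hφs hφmin h2'

end Parabola

/-! ## §10 Plane slices in `iteratedDeriv` form (the hypotheses of the structure theorem) -/

section PlaneSlices

/-- `∂_{eU}ᵏ F (u, s)` is the `k`-th derivative of the horizontal slice `t ↦ F (t, s)` at `u`. [folklore] -/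
theorem dirDerivIter_eU_eq_iteratedDeriv {F : ℝ × ℝ → ℝ} (hF : ContDiff ℝ ∞ F) (k : ℕ) (u s : ℝ) :
    dirDerivIter eU k F (u, s) = iteratedDeriv k (fun t : ℝ => F (t, s)) u := by
  have e := congrFun (iteratedDeriv_comp_line hF ((0 : ℝ), s) eU k) u
  rw [base_add_smul_eU] at e
  have hfun : (fun t : ℝ => F (((0 : ℝ), s) + t • eU)) = fun t => F (t, s) := by funext t; rw [base_add_smul_eU]
  rw [hfun] at e
  exact e.symm

/-- `∂_{eS} F (u, σ)` is the derivative of the vertical slice `t ↦ F (u, t)` at `σ`. [folklore] -/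
theorem dirDeriv_eS_eq_deriv {F : ℝ × ℝ → ℝ} (hF : ContDiff ℝ ∞ F) (u σ : ℝ) :
    dirDeriv eS F (u, σ) = deriv (fun t : ℝ => F (u, t)) σ := by
  have e := congrFun (iteratedDeriv_comp_line hF (u, (0 : ℝ)) eS 1) σ
  rw [base_add_smul_eS, iteratedDeriv_one] at e
  have hfun : (fun t : ℝ => F ((u, (0 : ℝ)) + t • eS)) = fun t => F (u, t) := by funext t; rw [base_add_smul_eS]
  rw [hfun] at e
  exact e.symm

/-- ★★ **THE STRUCTURE THEOREM WITH SLICE HYPOTHESES**: `C^∞` `F ≥ 0` on the plane with `F(u, 0) = 0` for all `u`, `F(0, s) = 0` for all `s`, and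
horizontal slices `t ↦ F(t, s)` with vanishing second and third derivative at `0` ⟹ `F (u, s) = u⁴ · s² · twoScaleRemainder F u s`.
(First derivatives vanish automatically at the minimum lines.) [folklore] -/
theorem eq_pow_four_mul_sq_of_slices {F : ℝ × ℝ → ℝ} (hF : ContDiff ℝ ∞ F) (hpos : ∀ q, 0 ≤ F q)
    (h0 : ∀ u : ℝ, F (u, 0) = 0) (hv0 : ∀ s : ℝ, F (0, s) = 0)
    (h2 : ∀ s : ℝ, iteratedDeriv 2 (fun t : ℝ => F (t, s)) 0 = 0) (h3 : ∀ s : ℝ, iteratedDeriv 3 (fun t : ℝ => F (t, s)) 0 = 0)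
    (u s : ℝ) : F (u, s) = u ^ 4 * s ^ 2 * twoScaleRemainder F u s := by
  refine eq_pow_four_mul_sq_mul_twoScaleRemainder hF h0 (fun u => ?_) (fun k hk s => ?_) u s
  · -- `∂_s F (u, 0) = 0`: `t ↦ F (u, t)` has a global minimum at `0`
    rw [dirDeriv_eS_eq_deriv hF]
    have hmin : IsLocalMin (fun t : ℝ => F (u, t)) 0 :=
      Filter.Eventually.of_forall fun t => by show F (u, 0) ≤ F (u, t); rw [h0 u]; exact hpos _
    exact hmin.deriv_eq_zero
  · rw [dirDerivIter_eU_eq_iteratedDeriv hF]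
    interval_cases k
    · simpa using hv0 s
    · rw [iteratedDeriv_one]
      have hmin : IsLocalMin (fun t : ℝ => F (t, s)) 0 :=
        Filter.Eventually.of_forall fun t => by show F (0, s) ≤ F (t, s); rw [hv0 s]; exact hpos _
      exact hmin.deriv_eq_zero
    · exact h2 s
    · exact h3 s

end PlaneSlices

end Summit.QuantumFields.YangMills.Theorems.SwapVirialDeficit.TwoScaleCalculus

end
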